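import Literature.MathematicalPhysics.QuantumFieldTheory.Balaban1983to89.B5Prop11Plancherel

/-!
# `Balaban1983to89.B5Eq129FreeResolventFibreCollapse` — T. Bałaban, *Propagators and renormalization transformations for lattice gauge
# theories. I*, Commun. Math. Phys. **95** (1984) 17–40 [Balaban1984PropagatorsI] (1.29) p. 23: **TRANSVERSE COLLAPSE FOR THE FREE RESOLVENT
# ON `Π_μ ℤ∕N_μ` — (i) the fibre sums `f(s) = Σ_{x_ν = s} k(x)` of a solution of `(L₀ + m)k = δ₀` solve the d = 1 equation on the cycle `ℤ∕N_ν`;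
# (ii) if the dipole `k(· − e_ν) − k` has one sign on every fibre, the ∇-row `Σ_x|k(x+e_ν) − k(x)|` EQUALS the total variation
# `Σ_s|f(s−1) − f(s)|` of the profile** — second of three files typing the (K∇) letter VALUE of the pub-balaban NE9 chain's storey J (row L13;
# P-J-1 of `t4-ne9-idea-1` g121∕g122; capstone `B5Eq129FreeResolventGradientRow`); this is why the row does not depend on `d`

statement-level skeleton of published theorems with citation tags; proofs where landed; nothing here is a claim about the Yang–Mills mass gap

CITATION HEADER (lean-in-tree rule).  Audit cell `pub-balaban`, sub-cell `t4`, BINDER row NE9; filed by NE9 crux-team LEAF PROVER 05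
(`b2b-balaban-t4-ne9-formalise-leaf-05`, gen 80).  OBJECT: [Balaban1984PropagatorsI] (1.29) p. 23's free lattice stencil on the finite torus in the
encoding of `B5Eq129FreeResolventSupBound` (`Tor N`, `unitVec`, the resolvent equation as a hypothesis; no `def`).  CONTENT: [folklore] bookkeeping
(re-indexing by lattice translations, `Σ_x = Σ_s Σ_{x_ν = s}`).  Independent of `B5Eq129FreeResolventKernelMonotone` (the one-sign hypothesis
`hsign` is DISPLAYED here and supplied there) so that both land without waiting on each other's olean.  Nothing of [B5′] is asserted.

WHAT IS PROVED (sorry-free; proof lane — 0 `def`).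
* **`fibreSum_resolvent`**: `t²[(f(s) − f(s−1)) + (f(s) − f(s+1))] + m·f(s) = δ_{s,0}` on `ℤ∕N_ν` (every transverse step permutes the fibre).
* **`sum_abs_sub_eq_sum_abs_fibreSum_sub`**: one sign per fibre ⟹ `Σ_x|k(x+e_ν) − k(x)| = Σ_s|f(s−1) − f(s)|`.
HONEST SCOPE.  Bookkeeping; no estimate.  ONE step of ONE letter of ONE un-opened storey of row L13; NOT the ∇-line of (3.42), NOT Tier P, NOT NE9
(cell pub-balaban: NE9 NOT PRINTED ∕ NOT PROVED; «NE9 ⇐ the named binders»; row WALLED ON A MODEL (O-NE9-1; #5 UNRULED); spine PROVED 0∕9; rung (B)+1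
finite T⁴ — NOT infinite volume, NOT mass gap, NOT BetaPertH, NOT Clay).  HONEST DEPENDENCY: continuum YM on T⁴ ⇐ BetaPertH ∧ nine spine estimates
(0/9 proved); BetaPertH ⇐ (D1) ∧ (D4) ∧ CAP+tail; G-an2-4 gates asym, D1 and NE2/3/4.  NEW file importing `B5Prop11Plancherel` only; nothing modified.
Net new unproved facts: 0.
-/

noncomputable section

open scoped BigOperators

namespace Literature.MathematicalPhysics.QuantumFieldTheory.Balaban1983to89.B5Eq129FreeResolventFibreCollapse

open B5Prop11Plancherel (Tor unitVec)

variable {d : ℕ} (N : Fin d → ℕ)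

/-- the ν-th coordinate of `x + e_ν`. [folklore] -/
private theorem add_unitVec_self (x : Tor N) (ν : Fin d) : (x + unitVec N ν) ν = x ν + 1 := by
  simp [unitVec]

/-- the other coordinates of `x + e_ν`. [folklore] -/
private theorem add_unitVec_ne (x : Tor N) {ν μ : Fin d} (h : μ ≠ ν) : (x + unitVec N ν) μ = x μ := by
  simp [unitVec, Pi.single_eq_of_ne h]

/-- the ν-th coordinate of `x − e_ν`. [folklore] -/
private theorem sub_unitVec_self (x : Tor N) (ν : Fin d) : (x - unitVec N ν) ν = x ν - 1 := by
  simp [unitVec]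

/-- the other coordinates of `x − e_ν`. [folklore] -/
private theorem sub_unitVec_ne (x : Tor N) {ν μ : Fin d} (h : μ ≠ ν) : (x - unitVec N ν) μ = x μ := by
  simp [unitVec, Pi.single_eq_of_ne h]

variable [∀ μ, NeZero (N μ)]

/-! ## §4 Transverse collapse: the ∇-row is the total variation of the fibre-summed (d = 1) profile -/

/-- fibre sums of the translate `k(· − e_ν)` are the shifted fibre sums. [folklore] -/
private theorem fibre_sum_sub_unitVec (k : Tor N → ℝ) (ν : Fin d) (s : ZMod (N ν)) :
    ∑ x : Tor N, (if x ν = s then k (x - unitVec N ν) else 0) = ∑ x : Tor N, (if x ν = s - 1 then k x else 0) :=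
  Fintype.sum_equiv (Equiv.subRight (unitVec N ν)) _ _ fun x => by
    simp only [Equiv.subRight_apply, sub_unitVec_self, sub_left_inj]

/-- fibre sums of the translate `k(· + e_ν)` are the shifted fibre sums. [folklore] -/
private theorem fibre_sum_add_unitVec (k : Tor N → ℝ) (ν : Fin d) (s : ZMod (N ν)) :
    ∑ x : Tor N, (if x ν = s then k (x + unitVec N ν) else 0) = ∑ x : Tor N, (if x ν = s + 1 then k x else 0) :=
  Fintype.sum_equiv (Equiv.addRight (unitVec N ν)) _ _ fun x => by
    simp only [Equiv.coe_addRight, add_unitVec_self, add_left_inj]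

/-- fibre sums are invariant under transverse steps. [folklore] -/
private theorem fibre_sum_sub_unitVec_ne (k : Tor N → ℝ) {ν μ : Fin d} (h : μ ≠ ν) (s : ZMod (N ν)) :
    ∑ x : Tor N, (if x ν = s then k (x - unitVec N μ) else 0) = ∑ x : Tor N, (if x ν = s then k x else 0) :=
  Fintype.sum_equiv (Equiv.subRight (unitVec N μ)) _ _ fun x => by
    simp only [Equiv.subRight_apply, sub_unitVec_ne N x (Ne.symm h)]

/-- fibre sums are invariant under forward transverse steps. [folklore] -/
private theorem fibre_sum_add_unitVec_ne (k : Tor N → ℝ) {ν μ : Fin d} (h : μ ≠ ν) (s : ZMod (N ν)) :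
    ∑ x : Tor N, (if x ν = s then k (x + unitVec N μ) else 0) = ∑ x : Tor N, (if x ν = s then k x else 0) :=
  Fintype.sum_equiv (Equiv.addRight (unitVec N μ)) _ _ fun x => by
    simp only [Equiv.coe_addRight, add_unitVec_ne N x (Ne.symm h)]

/-- `ite`-bookkeeping. [folklore] -/
private theorem ite_sub_zero (c : Prop) [Decidable c] (a b : ℝ) :
    (if c then a - b else 0) = (if c then a else 0) - (if c then b else 0) := by split_ifs <;> simp

/-- **THE FIBRE SUMS SOLVE THE d = 1 RESOLVENT EQUATION ON THE CYCLE `ℤ∕N_ν`.**  With `f(s) := Σ_{x : x_ν = s} k(x)`: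
`t²[(f(s) − f(s−1)) + (f(s) − f(s+1))] + m·f(s) = δ_{s,0}` — summing `(L₀ + m)k = δ₀` over the fibre kills every transverse difference
(each transverse step permutes the fibre).  This is why the ∇-row does not depend on `d`. [cite: Balaban1984PropagatorsI, (1.29) p.23] -/
theorem fibreSum_resolvent (t m : ℝ) {k : Tor N → ℝ}
    (hk : ∀ x, ∑ ν, t ^ 2 * ((k x - k (x - unitVec N ν)) + (k x - k (x + unitVec N ν))) + m * k x = if x = 0 then 1 else 0)
    (ν : Fin d) (s : ZMod (N ν)) :
    t ^ 2 * (((∑ x : Tor N, if x ν = s then k x else 0) - ∑ x : Tor N, if x ν = s - 1 then k x else 0) +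
        ((∑ x : Tor N, if x ν = s then k x else 0) - ∑ x : Tor N, if x ν = s + 1 then k x else 0)) +
      m * (∑ x : Tor N, if x ν = s then k x else 0) = if s = 0 then 1 else 0 := by
  have hsum : ∑ x : Tor N, (if x ν = s then
      (∑ μ, t ^ 2 * ((k x - k (x - unitVec N μ)) + (k x - k (x + unitVec N μ))) + m * k x) else 0) =
      ∑ x : Tor N, (if x ν = s then (if x = 0 then (1 : ℝ) else 0) else 0) :=
    Finset.sum_congr rfl fun x _ => by rw [hk x]
  -- the right-hand side: only the source contributes
  have hR : ∑ x : Tor N, (if x ν = s then (if x = 0 then (1 : ℝ) else 0) else 0) = if s = 0 then 1 else 0 := by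
    rw [show (∑ x : Tor N, (if x ν = s then (if x = 0 then (1 : ℝ) else 0) else 0)) =
        ∑ x : Tor N, (if x = 0 then (if x ν = s then (1 : ℝ) else 0) else 0) from
      Finset.sum_congr rfl fun x _ => by split_ifs <;> rfl, Finset.sum_ite_eq' Finset.univ (0 : Tor N)]
    simp only [Finset.mem_univ, if_true, Pi.zero_apply]
    by_cases hs : s = 0
    · subst hs; simp
    · simp [hs, Ne.symm hs]
  -- the left-hand side: linearity, transverse steps permute the fibre
  have e1 : ∀ x : Tor N, (if x ν = s then
      (∑ μ, t ^ 2 * ((k x - k (x - unitVec N μ)) + (k x - k (x + unitVec N μ))) + m * k x) else 0) =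
      t ^ 2 * (∑ μ, (((if x ν = s then k x else 0) - (if x ν = s then k (x - unitVec N μ) else 0)) +
        ((if x ν = s then k x else 0) - (if x ν = s then k (x + unitVec N μ) else 0)))) +
      m * (if x ν = s then k x else 0) := by
    intro x
    split_ifs
    · rw [Finset.mul_sum]
    · simp
  have hL : ∑ x : Tor N, (if x ν = s then
      (∑ μ, t ^ 2 * ((k x - k (x - unitVec N μ)) + (k x - k (x + unitVec N μ))) + m * k x) else 0) =
      t ^ 2 * (((∑ x : Tor N, if x ν = s then k x else 0) - ∑ x : Tor N, if x ν = s - 1 then k x else 0) +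
        ((∑ x : Tor N, if x ν = s then k x else 0) - ∑ x : Tor N, if x ν = s + 1 then k x else 0)) +
      m * (∑ x : Tor N, if x ν = s then k x else 0) := by
    rw [Finset.sum_congr rfl fun x _ => e1 x, Finset.sum_add_distrib, ← Finset.mul_sum, ← Finset.mul_sum, Finset.sum_comm]
    congr 1
    congr 1
    rw [Finset.sum_eq_single ν]
    · simp only [Finset.sum_add_distrib, Finset.sum_sub_distrib, fibre_sum_sub_unitVec, fibre_sum_add_unitVec]
    · intro μ _ hμ
      simp only [Finset.sum_add_distrib, Finset.sum_sub_distrib, fibre_sum_sub_unitVec_ne N k hμ,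
        fibre_sum_add_unitVec_ne N k hμ, sub_self, add_zero]
    · intro h; exact absurd (Finset.mem_univ ν) h
  rw [← hL, hsum, hR]

/-- per fibre, a one-signed family sums inside the absolute value. [folklore] -/
private theorem sum_ite_abs_eq_abs_sum_ite {u : Tor N → ℝ} {ν : Fin d} {s : ZMod (N ν)}
    (h : (∀ x : Tor N, x ν = s → 0 ≤ u x) ∨ (∀ x : Tor N, x ν = s → u x ≤ 0)) :
    ∑ x : Tor N, (if x ν = s then |u x| else 0) = |∑ x : Tor N, (if x ν = s then u x else 0)| := by
  rcases h with h | h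
  · have hterm : ∀ x : Tor N, (if x ν = s then |u x| else 0) = (if x ν = s then u x else 0) := fun x => by
      split_ifs with hx
      · exact abs_of_nonneg (h x hx)
      · rfl
    rw [Finset.sum_congr rfl fun x _ => hterm x, abs_of_nonneg]
    exact Finset.sum_nonneg fun x _ => by split_ifs with hx <;> [exact h x hx; exact le_rfl]
  · have hterm : ∀ x : Tor N, (if x ν = s then |u x| else 0) = -(if x ν = s then u x else 0) := fun x => by
      split_ifs with hx
      · exact abs_of_nonpos (h x hx)
      · simp
    rw [Finset.sum_congr rfl fun x _ => hterm x, Finset.sum_neg_distrib, abs_of_nonpos]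
    exact Finset.sum_nonpos fun x _ => by split_ifs with hx <;> [exact h x hx; exact le_rfl]

/-- **TRANSVERSE COLLAPSE: THE ∇-ROW IS THE TOTAL VARIATION OF THE FIBRE-SUMMED PROFILE.**  For the resolvent kernel
`(L₀ + m)k = δ₀` (weight `t²`, `m > 0`) on `Π_μ ℤ∕N_μ` and every direction `ν`:
`Σ_x |k(x + e_ν) − k(x)| = Σ_{s ∈ ℤ∕N_ν} |f(s−1) − f(s)|`, `f(s) = Σ_{x_ν = s} k(x)` — because on each fibre the dipole has one sign
(hypothesis `hsign` — for the resolvent kernel this is `B5Eq129FreeResolventKernelMonotone.dipole_sign_on_fibre`), so the absolute values move outside the transverse sums.  With `fibreSum_resolvent` the right-hand side is a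
d = 1 quantity: the total variation of the cycle resolvent profile (closed form: the sequel `B5Eq129FreeResolventCycleProfile`).
[cite: Balaban1984PropagatorsI, (1.29) p.23] -/
theorem sum_abs_sub_eq_sum_abs_fibreSum_sub (k : Tor N → ℝ) (ν : Fin d)
    (hsign : ∀ s : ZMod (N ν), (∀ x : Tor N, x ν = s → 0 ≤ k (x - unitVec N ν) - k x) ∨
      (∀ x : Tor N, x ν = s → k (x - unitVec N ν) - k x ≤ 0)) :
    ∑ x : Tor N, |k (x + unitVec N ν) - k x| =
      ∑ s : ZMod (N ν), |(∑ x : Tor N, if x ν = s - 1 then k x else 0) - ∑ x : Tor N, if x ν = s then k x else 0| := by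
  -- re-index to the backward dipole `u(x) = k(x − e_ν) − k(x)`
  have h1 : ∑ x : Tor N, |k (x + unitVec N ν) - k x| = ∑ x : Tor N, |k (x - unitVec N ν) - k x| :=
    Fintype.sum_equiv (Equiv.addRight (unitVec N ν)) _ _ fun x => by
      show _ = |k (x + unitVec N ν - unitVec N ν) - k (x + unitVec N ν)|
      rw [add_sub_cancel_right, abs_sub_comm]
  -- decompose over the fibres of `x ↦ x_ν`
  have h2 : ∑ x : Tor N, |k (x - unitVec N ν) - k x| =
      ∑ s : ZMod (N ν), ∑ x : Tor N, (if x ν = s then |k (x - unitVec N ν) - k x| else 0) := by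
    rw [Finset.sum_comm]
    exact Finset.sum_congr rfl fun x _ => by rw [Finset.sum_ite_eq Finset.univ (x ν)]; simp
  rw [h1, h2]
  refine Finset.sum_congr rfl fun s _ => ?_
  -- one sign per fibre
  rw [sum_ite_abs_eq_abs_sum_ite N (hsign s)]
  simp only [ite_sub_zero, Finset.sum_sub_distrib, fibre_sum_sub_unitVec]

end Literature.MathematicalPhysics.QuantumFieldTheory.Balaban1983to89.B5Eq129FreeResolventFibreCollapse

end
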